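import Literature.Analysis.FluidPDE.TypeIAncientMild
import Literature.Analysis.FluidPDE.AncientSimilarityVorticity
import Literature.Analysis.FluidPDE.NSBoundedMildOseenClassical
import Literature.Analysis.FluidPDE.ClassicalSolutionGlue
import HarnessLib

/-!
# Type I ancient mild fields are classical on every window; their vorticity equation in
  backward similarity variables

Analysis/FluidPDE support file (all results proved; companion of `TypeIAncientMild.lean`; used by
the crux `MustSqueeze` of route SqueezeCycle, NavierStokesRegularity). For a field `u` of the class
`IsTypeIAncientMild C u` (jointly smooth on `t < 0`, divergence free, KNSS-mild between all pairs
of negative times, `‖u‖ ≤ C/√(−t)`):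

* `IsTypeIAncientMild.exists_isClassicalNSSolutionOn_Ioo` — on every window `(t₀, 0)`, `t₀ < 0`,
  `u` is a classical solution of the unforced Navier–Stokes system (`ν = 1`) for some smooth
  pressure: the two-time duality identity (`IsTypeIAncientMild.isAncientMildSolution`,
  Koch–Nadirashvili–Seregin–Šverák 2009, Rem. 4.1) translated to `(0, −t₀)` is the tree's
  duality-form mild solution from the bounded datum `u(t₀)`, and Fabes–Jones–Rivière's theorem
  for smooth bounded mild solutions (`classical_of_smooth_isMildNSSolutionOn_holds`) gives the
  pressure; translate back.
* `IsTypeIAncientMild.lerayVorticity_eq` — consequently the similarity-variable vorticity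
  `Ω = lerayVorticity u` (`Ω(s,y) = (−t)ω(t,x)`, `U = lerayOrbit u`) satisfies, for **all**
  `s ∈ ℝ` and `y`, the transport–stretching equation
  `∂ₛΩ + Ω + ½(y·∇)Ω + (U·∇)Ω = (Ω·∇)U + ΔΩ` (the tree's `IsBackwardLeraySolutionOn.vorticity_eq`
  on each window, the window time-derivative being the two-sided one).

## References

* E. B. Fabes, B. F. Jones, N. M. Rivière, Arch. Rational Mech. Anal. 45 (1972) 222–240,
  Thm. 2.1. [FabesJonesRiviere1972]
* G. Koch, N. Nadirashvili, G. Seregin, V. Šverák, Acta Math. 203 (2009) 83–105 =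
  arXiv:0709.3599, Rem. 4.1 and §6. [KochNadirashviliSereginSverak2009]
* A. J. Majda, A. L. Bertozzi, *Vorticity and Incompressible Flow* (CUP 2002), §2.4,
  eq. (2.110). [MajdaBertozziCUP2002]
-/

noncomputable section

open MeasureTheory Set Function Filter Real
open _root_.Topology
open scoped RealInnerProductSpace NNReal ENNReal Laplacian ContDiff

namespace Literature.Analysis.FluidPDE

variable {E : Type*} [NormedAddCommGroup E] [InnerProductSpace ℝ E] [FiniteDimensional ℝ E]
  [MeasurableSpace E] [BorelSpace E]

/-- **A Type I ancient mild field is a classical Navier–Stokes solution on every window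
`(t₀, 0)`, `t₀ < 0`** (unit viscosity, zero force), for some smooth pressure: mild (duality form,
KNSS 2009, Rem. 4.1) + smooth + bounded ⇒ classical (Fabes–Jones–Rivière 1972, Thm. 2.1, the
tree's `classical_of_smooth_isMildNSSolutionOn_holds`). [cite: FabesJonesRiviere1972, Thm. 2.1] -/
theorem IsTypeIAncientMild.exists_isClassicalNSSolutionOn_Ioo {C : ℝ} {u : ℝ → E → E}
    (hu : IsTypeIAncientMild C u) {t₀ : ℝ} (ht₀ : t₀ < 0) :
    ∃ p : ℝ → E → ℝ, IsClassicalNSSolutionOn (Ioo t₀ 0) 1 0 u p := by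
  have hT : 0 < -t₀ := neg_pos.2 ht₀
  set v : ℝ → E → E := fun t => u (t + t₀) with hv
  -- mild solution in duality form from the datum `u t₀` on `(0, -t₀)`
  have hmild : IsMildNSSolutionOn (Ioo 0 (-t₀)) 1 0 (u t₀) v :=
    (hu.isAncientMildSolution.isMildNSSolutionOn_translate t₀).mono Ioo_subset_Ico_self
  -- joint smoothness of the translate
  have hsmI : IsSmoothSpaceTimeOn (Iio 0) u := hu.contDiffOn
  have hsm : IsSmoothSpaceTimeOn (Ioo 0 (-t₀)) v := by
    refine (hsmI.comp_add_right t₀).mono fun t ht => ?_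
    simp only [mem_preimage, mem_Iio]
    linarith [ht.2]
  -- uniform bound on `(0, T₁)`, `T₁ < -t₀`
  have hC0 : 0 ≤ C := hu.nonneg
  have hbdd : ∀ T₁ ∈ Ioo 0 (-t₀), ∃ K : ℝ≥0∞, K < ⊤ ∧ ∀ t ∈ Ioo 0 T₁, eLpNorm (v t) ∞ volume ≤ K := by
    intro T₁ hT₁
    have hneg : 0 < -(T₁ + t₀) := by linarith [hT₁.2]
    refine ⟨ENNReal.ofReal (C / Real.sqrt (-(T₁ + t₀))), ENNReal.ofReal_lt_top, fun t ht => ?_⟩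
    rw [eLpNorm_exponent_top]
    refine eLpNormEssSup_le_of_ae_bound (Eventually.of_forall fun x => ?_)
    have htt : t + t₀ < 0 := by linarith [ht.2, hT₁.2]
    calc ‖v t x‖ = ‖u (t + t₀) x‖ := rfl
      _ ≤ C / Real.sqrt (-(t + t₀)) := hu.norm_le htt x
      _ ≤ C / Real.sqrt (-(T₁ + t₀)) := by
          refine div_le_div_of_nonneg_left hC0 (Real.sqrt_pos.2 hneg) ?_
          exact Real.sqrt_le_sqrt (by linarith [ht.2])
  -- the datum: measurable and integrable against Gaussians (bounded)
  have hu₀m : AEStronglyMeasurable (u t₀) volume := hu.aestronglyMeasurable_slice ht₀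
  have hu₀G : ∀ a : ℝ, 0 < a →
      Integrable (fun y => UnboundedOperators.heatKernel a y * ‖u t₀ y‖) volume := by
    intro a ha
    have hK : Integrable (UnboundedOperators.heatKernel (E := E) a) volume :=
      UnboundedOperators.integrable_heatKernel_holds ha
    have h := hK.bdd_mul (c := C / Real.sqrt (-t₀)) hu₀m.norm
      (Eventually.of_forall fun y => by
        rw [norm_norm]; exact hu.norm_le ht₀ y)
    refine h.congr (Eventually.of_forall fun y => ?_)
    simp only [mul_comm]
  obtain ⟨q, hcl⟩ := classical_of_smooth_isMildNSSolutionOn_holds E one_pos hT hu₀m hu₀G hsm hbdd hmild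
  -- translate back to `(t₀, 0)`
  refine ⟨fun t => q (t - t₀), ?_⟩
  have h1 := hcl.comp_add_right (-t₀)
  have hset : (fun t : ℝ => t + -t₀) ⁻¹' Ioo 0 (-t₀) = Ioo t₀ 0 := by
    ext t
    simp only [mem_preimage, mem_Ioo]
    constructor
    · rintro ⟨h1, h2⟩; exact ⟨by linarith, by linarith⟩
    · rintro ⟨h1, h2⟩; exact ⟨by linarith, by linarith⟩
  rw [hset] at h1
  have hf : (fun t : ℝ => (0 : ℝ → E → E) (t + -t₀)) = 0 := by funext t; rfl
  have hu' : (fun t : ℝ => v (t + -t₀)) = u := by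
    funext t; simp only [hv]; congr 1; ring
  have hp' : (fun t : ℝ => q (t + -t₀)) = fun t => q (t - t₀) := by
    funext t; rw [← sub_eq_add_neg]
  rw [hf, hu', hp'] at h1
  exact h1

/-- **The vorticity equation in backward similarity variables, for every `s ∈ ℝ`.** For a Type I
ancient mild field `u` on `ℝ³`, the similarity vorticity `Ω = lerayVorticity u` and velocity
`U = lerayOrbit u` satisfy `∂ₛΩ + Ω + ½(y·∇)Ω + (U·∇)Ω = (Ω·∇)U + ΔΩ` pointwise on `ℝ × ℝ³`
(two-sided `∂ₛ = timeDerivWithin univ`): the classical equations hold on every window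
(`exists_isClassicalNSSolutionOn_Ioo`), which in similarity variables is the backward Leray
system, whose curl is this equation (`IsBackwardLeraySolutionOn.vorticity_eq`; Chae–Wolf 2017,
§4; Majda–Bertozzi, (2.110)). [cite: MajdaBertozziCUP2002, §2.4 Prop. 2.4 eq. (2.110)] -/
theorem IsTypeIAncientMild.lerayVorticity_eq {C : ℝ} {u : ℝ → EuclideanSpace ℝ (Fin 3) → EuclideanSpace ℝ (Fin 3)}
    (hu : IsTypeIAncientMild C u) (s : ℝ) (y : EuclideanSpace ℝ (Fin 3)) :
    timeDerivWithin univ (lerayVorticity u) s y + lerayVorticity u s y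
        + (1 / 2 : ℝ) • fderiv ℝ (lerayVorticity u s) y y
        + convect (lerayOrbit u s) (lerayVorticity u s) y =
      convect (lerayVorticity u s) (lerayOrbit u s) y + (Δ (lerayVorticity u s)) y := by
  -- a window containing `t = -e^{-s}`
  set t₀ : ℝ := -(2 * Real.exp (-s)) with ht₀def
  have ht₀ : t₀ < 0 := by rw [ht₀def]; exact neg_neg_of_pos (by positivity)
  obtain ⟨p, hcl⟩ := hu.exists_isClassicalNSSolutionOn_Ioo ht₀
  have hL := (isClassicalNSSolutionOn_iff_isBackwardLeraySolutionOn_lerayOrbit isOpen_Ioo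
    Ioo_subset_Iio_self).1 hcl
  set S : Set ℝ := ancientSimTime ⁻¹' Ioo t₀ 0 with hSdef
  have hSo : IsOpen S := isOpen_Ioo.preimage continuous_ancientSimTime
  have hs : s ∈ S := by
    rw [hSdef, mem_preimage, ancientSimTime_apply, mem_Ioo, ht₀def]
    exact ⟨by linarith [Real.exp_pos (-s)], neg_neg_of_pos (Real.exp_pos _)⟩
  have hcl' : S ⊆ closure (interior S) := by
    rw [hSo.interior_eq]; exact subset_closure
  have key := hL.vorticity_eq hSo.uniqueDiffOn hcl' hs y
  -- `vorticity (lerayOrbit u) = lerayVorticity u` and the window derivative is the two-sided one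
  have hv : vorticity (lerayOrbit u) = lerayVorticity u := by
    funext σ z; rw [lerayVorticity_apply, vorticity_apply]
  have hder : timeDerivWithin S (vorticity (lerayOrbit u)) s y =
      timeDerivWithin univ (lerayVorticity u) s y := by
    rw [timeDerivWithin_eq_deriv_of_isOpen_subset hSo le_rfl hs,
      timeDerivWithin_eq_deriv_of_isOpen_subset hSo (subset_univ S) hs, hv]
  rw [hder, hv, one_smul] at key
  exact key

end Literature.Analysis.FluidPDE

end
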